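import Summits.BirchSwinnertonDyer.Rank1Residual.Additive.LegendreTwistRelationOfCurveTwist
import Summits.BirchSwinnertonDyer.Rank1Residual.Additive.TameBranchRigidity
import Summits.BirchSwinnertonDyer.Rank1Residual.Additive.ChiBranchConstantTerm
import Literature.NumberTheory.EllipticCurves.PAdicLFunctionBranchInterpolationProofs
import HarnessLib

/-!
# Class N10 / X3♯(G-ord), X4♯(G-ord), defect 2: the POWER-SERIES DICTIONARY — the E-normalised tame
# branch of the additive curve IS `c · L_p(f_{E♭}, α, ω^{(p−1)/2}, T)`, the Mazur–Tate–Teitelbaum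
# branch of its good ordinary twist (cell `b2b-bsdres`, sub-cell additive-p2, gen 22)

HONEST FRAMING (cell `b2b-bsdres`, run/shared/lean/b2b/bsd-rank1-residual/, verbatim in every
file): the goal of the cell is to DELETE the COMBINATION-SHAPED residual classes of the
Birch–Swinnerton-Dyer formula for ALL analytic-rank `≤ 1` elliptic curves over `ℚ` — "full BSD
formula for every rank `≤ 1` curve in class `C`" assembled STRICTLY from published theorems — so
that the rank-`≤ 1` remainder becomes exactly the CONSTRUCTION-SHAPED classes, which are TYPED
(missing-input `Prop`s), NOT attempted. This is not "finishing BSD". Sub-cell `additive-p2`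
(X3♯(G-ord) / X4♯(G-ord)), generation 22: research route; labels / census / located gap UNCHANGED;
nothing is booked. THEOREMS ONLY: no definition, no named fact, no conjecture node.

## What and why

Two currencies for the same analytic object live in the tree on the defect-2 rows
(`E = E♭ ⊗ χ_{p*}`, Kodaira `I₀*`, `E♭` GOOD ORDINARY at the odd prime `p`):
* the **E-normalised tame branch** `B_E` of cc-typer-2's interpolation package
  `IsTameBranchOf f_E p χ_p α B` (`TameBranchLower.lean` §1: bounded, `B(0) = α⁻¹[0]⁺_{f_E}`,
  `B(κ(γ)−1) = α^{−m}p^{−1}τ(χ_p,ψ_κ)∑_b κ(b)[b/p^m]⁺_{f_E}` at every primitive wild `κ` of conductor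
  `p^m ≥ p²`) — the object of the typed main conjecture `TameBranchRatCharEqAt W p`, of the typed
  Kato half `TameBranchRatDvdAt W p` (this seat, gen 20) and of A227 (Delbourgo 2002 Thm. (C));
  on (G-ord, `e = 2`) at `p ≡ 1 (mod 4)` it EXISTS and is UNIQUE as a theorem
  (`existsUnique_isTameBranchOf_of_goodOrd_twist`, cc-typer-2 GEN 3, produced as the Mellin
  transform of the measure of the `p`-stabilised twist partner — an EXISTENTIAL power series);
* the **MTT branch** `B_{(p−1)/2} = L_p(g, α, ω^{(p−1)/2}, T) = padicLFunctionBranch g α (p/2)` of the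
  newform `g` of `E♭` at its unit root `α` (`PAdicLFunctionBranch`; Mazur–Tate–Teitelbaum 1986
  §I.13) — the object of Kato 2004 Thm. 17.4 (3) / Wuthrich 2014 Thm. 16 read on the component
  `(p−1)/2` (`Kato2004.charIdeal_dvd_padicLFunctionBranch_component_of_surjective[_of_half]`,
  `Wuthrich2014.charIdeal_dvd_padicLFunctionBranch_component[_of_half]`) and of this seat's gen-19
  full-series brick `ι g = C(u·ϖ)·B_{(p−1)/2}` (`isTorsion_and_exists_iota_eq_branch_of_katoComponent`).
cc-typer-2 recorded the dictionary between them "at the level of power series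
(`B = c·ϖ⁻¹·L_p(f♭, α, ω^{(p−1)/2}, T)`) needs the wild-character interpolation of the branch, which
the tree has only at `T = 0` — not claimed" (`TameBranchOfSemistableTwist.lean`; HANDOFF cc-typer-2
GEN 3 'DEAD ENDS'). That interpolation is now a tree theorem
(`Literature/…/PAdicLFunctionBranchInterpolationProofs.lean`, this seat gen 22:
`hasSum_coeff_padicLFunctionBranch_mul_pow_of_isNewformOf`, from the abstract Mellin transform of
`PAdicMeasureTransform` applied to the twisted measure `ω^i μ` of `PAdicMeasureTransformBranches`),
and THIS FILE proves the dictionary: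

* §1 `teichWeight_half_castHom_eq_legendreChar`: the MTT weight `ω(a)^{(p−1)/2}` IS the Legendre
  character `(a/p)` (Euler's criterion `teichRep_pow_half_eq_legendreSym`, additive-p4; `0` on
  non-units on both sides).
* §2 `isTameBranchOf_legendre_C_mul_padicLFunctionBranch`: for `V` (`E♭`) globally minimal and
  ordinary at the odd prime `p` with newform `g`, `α = unitRoot V p`, and any weight-2 cusp form `f`
  satisfying the Legendre twist relation `LegendreTwistPlusRel p f g c` (`[s]⁺_f = c∑_u(u/p)[s+u/p]⁺_g`;
  PROVED for `f = f_E`, `E ≅ V ⊗ χ_p`, `p ≡ 1 (mod 4)` by cc-typer-2's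
  `exists_legendreTwistPlusRel_of_twist`):
  **`IsTameBranchOf f p (ι∘χ_p) α (C(c) · L_p(g, α, ω^{(p−1)/2}, T))`** — boundedness from
  `norm_padicLBranchCoeff_le`, the constant term from `constantCoeff_padicLFunctionBranch_half`
  (`= α⁻¹∑_a(a/p)[a/p]⁺_g`) and the relation at `s = 0`, the interpolation rows from the new
  branch interpolation + §1 + cc-typer-2's un-twisting `sum_mul_twistPartnerMeasure_eq` (run with the
  UNSTABILISED symbol `Φ = c·[·]⁺_g`: the Gauss-sum bookkeeping `τ(ε,ψ_κ)τ(ε̄,ψ_κ) = ε(−1)p` is theirs).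
* §3 `IsTameBranchOf.eq_C_mul_padicLFunctionBranch` (uniqueness, `IsTameBranchOf.unique`): EVERY
  E-normalised tame branch for `(f, χ_p, unitRoot V p)` IS `C(c)·L_p(g, α, ω^{(p−1)/2}, T)`; curve-level
  forms at `p ≡ 1 (mod 4)` (`exists_forall_isTameBranchOf_iff_of_goodOrd_twist`: `∃ c, ∀ B,
  IsTameBranchOf f p (ι∘χ_p) (unitRoot V p) B ↔ B = C(c)·B_{(p−1)/2}`), and with gen 21's tuple
  rigidity the dichotomy for EVERY tuple `(ε', α', B')` of the package
  (`IsTameBranchOf.eq_zero_or_eq_C_mul_padicLFunctionBranch_of_goodOrd_twist`).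

So on X4♯(G-ord)/X3♯(G-ord) ∩ `I₀*` at `p ≡ 1 (mod 4)` the universal quantifier of
`TameBranchRatDvdAt` / `TameBranchRatCharEqAt` / A227 ranges over (a rational multiple of) ONE NAMED
POWER SERIES of `E♭`'s classical Iwasawa theory, the one Kato's theorem is about — the consumer
(Kato 17.4 (3) ⟹ `TameBranchRatDvdAt` on those rows WITHOUT Delbourgo 2002 (C), i.e. without the
`Del02-KKT-inprep` print dependency) is the companion `TameBranchKatoDivisibilityOfKato.lean`.

What is NOT claimed: the odd branch `p ≡ 3 (mod 4)` (minus symbols; cc-typer-2 GEN 4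
`LegendreTwistMinusRel`, `padicLFunctionMinusBranch` — the twin needs the minus-measure interpolation,
same proof, not in this file); the (M) rows (`E♭` multiplicative: one-term measure
`PAdicLFunctionPlusMult`); `c ≠ 0` (true — `[·]⁺_{f_E} ≢ 0` — but not needed: `c = 0` rows are
vacuous for every consumer); any Literature fact; any booking. Labels UNCHANGED.

References: Mazur–Tate–Teitelbaum, Invent. Math. 84 (1986) §I.8, §I.10 (10.1), §I.13–I.14 (14.3)
[MazurTateTeitelbaum1986Invent]; Delbourgo, Compositio Math. 113 (1998) §1.5–1.6 [Delbourgo1998];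
Kato, Astérisque 295 (2004) Thm. 17.4 [Kato2004Asterisque]; Wuthrich, Doc. Math. 19 (2014) Thm. 16
[Wuthrich2014]; HOME/class-closure/N10/TRANSPORT-TEMPLATE.md R2; cc-typer-2's
`TameBranchOfTwistPartner.lean`, `TameBranchOfSemistableTwist.lean`, `LegendreTwistRelationOfCurveTwist.lean`.
-/

noncomputable section

open scoped Classical MatrixGroups ModularForm

open CongruenceSubgroup

namespace Summit.BirchSwinnertonDyer.Rank1Residual.Additive

open Literature.NumberTheory.EllipticCurves Literature.NumberTheory.EllipticCurves.ModularForms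
  Literature.NumberTheory.EllipticCurves.Rank1Residual WeierstrassCurve

/-! ### §1 The MTT weight `ω^{(p−1)/2}` is the Legendre character -/

section Weight

variable (p : ℕ) [hp : Fact p.Prime]

/-- **`ω(a)^{(p−1)/2} = (a/p)` as `ℚ_p`-valued weights on `ℤ/p^L`, `L ≥ e₀`, `p` odd**: the
Mazur–Tate–Teitelbaum weight `teichWeight p (p/2)` of the class of `a` modulo `p^{e₀} = p` (`0` on
non-units) equals cc-typer-2's Legendre character at `a mod p` — Euler's criterion for the
Teichmüller representative (`teichRep_pow_half_eq_legendreSym`, additive-p4) on the units, and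
`(a/p) = 0` for `p ∣ a`. [folklore] -/
theorem teichWeight_half_castHom_eq_legendreChar (hp2 : p ≠ 2) {L : ℕ}
    (hL : cyclotomicExponent p ≤ L) (a : ZMod (p ^ L)) :
    teichWeight p (p / 2) (ZMod.castHom (pow_dvd_pow p hL) (ZMod (p ^ cyclotomicExponent p)) a) =
      legendreChar p ((a.val : ℕ) : ZMod p) := by
  have hpP : p.Prime := hp.out
  haveI : NeZero (p ^ L) := ⟨pow_ne_zero _ hpP.ne_zero⟩
  haveI : NeZero (p ^ cyclotomicExponent p) := ⟨pow_ne_zero _ hpP.ne_zero⟩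
  have he0 : cyclotomicExponent p ≠ 0 := cyclotomicExponent_ne_zero p
  have hcast : ZMod.castHom (pow_dvd_pow p hL) (ZMod (p ^ cyclotomicExponent p)) a =
      ((a.val : ℕ) : ZMod (p ^ cyclotomicExponent p)) := by
    rw [ZMod.castHom_apply, ZMod.cast_eq_val]
  -- the Legendre side only depends on `a.val mod p`
  have hleg : legendreChar p ((a.val : ℕ) : ZMod p) = ((legendreSym p (a.val : ℤ) : ℤ) : ℚ_[p]) := by
    rw [legendreChar_apply, ZMod.val_natCast, Int.natCast_mod, ← legendreSym.mod]
  rw [hcast, hleg]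
  by_cases hpa : p ∣ a.val
  · -- non-unit: both sides vanish
    have hnu : ¬ IsUnit ((a.val : ℕ) : ZMod (p ^ cyclotomicExponent p)) := by
      rw [ZMod.isUnit_iff_coprime]
      intro hcop
      have h1 : Nat.Coprime a.val p := hcop.coprime_dvd_right (dvd_pow_self p he0)
      exact hpP.ne_one ((Nat.coprime_comm.mp h1).eq_one_of_dvd hpa |>.symm ▸ rfl)
    rw [teichWeight, dif_neg hnu, (legendreSym.eq_zero_iff p (a.val : ℤ)).mpr
      (by exact_mod_cast (ZMod.natCast_eq_zero_iff a.val p).mpr hpa), Int.cast_zero]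
  · -- unit: Euler's criterion for the Teichmüller representative
    have hu : IsUnit ((a.val : ℕ) : ZMod (p ^ cyclotomicExponent p)) := by
      rw [ZMod.isUnit_iff_coprime]
      exact Nat.Coprime.pow_right _ ((hpP.coprime_iff_not_dvd.mpr hpa).symm)
    obtain ⟨u, hu'⟩ := hu
    rw [← hu', teichWeight_units, ← PadicInt.coe_pow, teichRep_pow_half_eq_legendreSym p hp2 u,
      PadicInt.coe_intCast, hu', ZMod.val_natCast, Int.natCast_mod,
      legendreSym.mod p ((a.val : ℤ) % ((p ^ cyclotomicExponent p : ℕ) : ℤ)),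
      Int.emod_emod_of_dvd _ (by exact_mod_cast dvd_pow_self p he0), ← legendreSym.mod]

end Weight

/-! ### §2 The dictionary: `C(c)·L_p(g, α, ω^{(p−1)/2}, T)` IS an E-normalised tame branch -/

section Dictionary

variable {p : ℕ} [hp : Fact p.Prime] {N N' : ℕ} [NeZero N'] {f : CuspForm (Gamma0 N) 2}
  {g : CuspForm (Gamma0 N') 2} (V : WeierstrassCurve ℚ) [V.IsElliptic] [V.IsGloballyMinimal]

/-- **THE DICTIONARY (even branch).** Let `V` (`E♭`) be globally minimal and ORDINARY at the odd prime
`p`, `g` its newform, `α = unitRoot V p`, and let the weight-2 cusp form `f` satisfy the Legendre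
twist relation `LegendreTwistPlusRel p f g c` (`[s]⁺_f = c·∑_{u mod p}(u/p)[s+u/p]⁺_g`; for `f = f_E`,
`E ≅ V ⊗ χ_p`, `p ≡ 1 (mod 4)` a THEOREM, `exists_legendreTwistPlusRel_of_twist`). Then the power
series `C(c)·L_p(g, α, ω^{(p−1)/2}, T)` (`padicLFunctionBranch g α (p/2)`, MTT §I.13) satisfies
cc-typer-2's interpolation package `IsTameBranchOf f p (ι∘χ_p) α`: it is bounded
(`norm_padicLBranchCoeff_le`), its constant term is `c·α⁻¹∑_a(a/p)[a/p]⁺_g = α⁻¹[0]⁺_f`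
(`constantCoeff_padicLFunctionBranch_half` and the relation at `s = 0`), and at a primitive wild
`κ` of conductor `p^m ≥ p²` its value is `c·α^{−m}∑_a κ(a)(a/p)[a/p^m]⁺_g`
(`hasSum_coeff_padicLFunctionBranch_mul_pow_of_isNewformOf` + §1)
`= α^{−m}p^{−1}τ(χ_p,ψ_κ)∑_b κ(b)[b/p^m]⁺_f` (cc-typer-2's un-twisting
`sum_mul_twistPartnerMeasure_eq`, run with the unstabilised symbol `Φ = c·[·]⁺_g`).
[cite: MazurTateTeitelbaum1986Invent, §I.13–I.14 (14.3)] [cite: Delbourgo1998, §1.5–1.6] -/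
theorem isTameBranchOf_legendre_C_mul_padicLFunctionBranch (hp2 : p ≠ 2) (hord : IsOrdinaryAt V p)
    (hg : IsNewformOf V g) {c : ℚ} (hrel : LegendreTwistPlusRel p f g c) :
    IsTameBranchOf f p ((legendreChar p).ringHomComp (algebraMap ℚ_[p] ℂ_[p]))
      (unitRoot V p : ℚ_[p])
      (PowerSeries.C (c : ℚ_[p]) * padicLFunctionBranch g (unitRoot V p : ℚ_[p]) (p / 2)) := by
  haveI : NeZero p := ⟨hp.out.ne_zero⟩
  set α : ℚ_[p] := (unitRoot V p : ℚ_[p]) with hα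
  set ι : ℚ_[p] →+* ℂ_[p] := algebraMap ℚ_[p] ℂ_[p] with hι
  have hdist := msdMeasure_distribution_of_isNewformOf (f := g) hord hg
  obtain ⟨C, hC⟩ := exists_norm_msdMeasure_le_of_isNewformOf (f := g) hord hg
  -- the unstabilised partner symbol `Φ = c·[·]⁺_g`
  set Φ : ℚ → ℚ_[p] := fun r ↦ (c : ℚ_[p]) * ((ratPlusSymbol g r : ℚ) : ℚ_[p]) with hΦ
  have hper : ∀ s, Φ (s + 1) = Φ s := fun s ↦ by
    simp only [hΦ]
    rw [show (s + 1 : ℚ) = s + ((1 : ℤ) : ℚ) by push_cast; rfl, ratPlusSymbol_add_intCast_eq]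
  have hx : ∀ s, ((ratPlusSymbol f s : ℚ) : ℚ_[p]) =
      ∑ b : ZMod p, (legendreChar p)⁻¹ b * Φ (s + (b.val : ℚ) / p) := fun s ↦ hrel.cast_eq_twist s
  refine ⟨⟨‖(c : ℚ_[p])‖ * C, fun n ↦ ?_⟩, ?_, ?_⟩
  · -- bounded
    rw [PowerSeries.coeff_C_mul, norm_mul, coeff_padicLFunctionBranch]
    exact mul_le_mul_of_nonneg_left (norm_padicLBranchCoeff_le g α hdist hC _ n) (norm_nonneg _)
  · -- constant term
    rw [map_mul, PowerSeries.constantCoeff_C, constantCoeff_padicLFunctionBranch_half p hp2 V hord hg]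
    have h0 : ratPlusSymbol f 0 = c * legendrePlusSymbolSum g p := by
      rw [hrel 0, legendrePlusSymbolSum_def]
      simp_rw [zero_add]
    rw [h0]
    push_cast
    ring
  · -- interpolation at primitive wild `κ` of conductor `p^m`, `m ≥ 2`
    intro m hm κ hκ heven hordκ
    obtain ⟨m', rfl⟩ : ∃ m', m = m' + 1 := ⟨m - 1, by omega⟩
    have he : cyclotomicExponent p ≤ m' := by rw [cyclotomicExponent_eq_one p hp2]; omega
    have h1 := hasSum_coeff_padicLFunctionBranch_mul_pow_of_isNewformOf (W := V) hord hg (p / 2) he κ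
      hκ heven hordκ
    have h2 := h1.mul_left (ι (c : ℚ_[p]))
    have hval := sum_mul_twistPartnerMeasure_eq (f := f) (ã := α) hm (legendreChar_ne_one p hp2) hper
      hx hκ
    -- the value: `∑_a κ(a)·ι(α^{-m} χ_p(a) c [a/p^m]⁺_g) = ι(c)·ι(α^{-m})·∑_a κ(a) ι(ω(a)^{(p-1)/2}) [a/p^m]⁺_g`
    have hv : ∑ a : ZMod (p ^ (m' + 1)), κ a * ι (twistPartnerMeasure (legendreChar p) Φ α
          ((ratPlusSymbol f 0 : ℚ) : ℚ_[p]) (m' + 1) a) =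
        ι (c : ℚ_[p]) * (ι (α⁻¹ ^ (m' + 1)) * ∑ a : ZMod (p ^ (m' + 1)), κ a *
          ι (teichWeight p (p / 2) (ZMod.castHom (pow_dvd_pow p (he.trans m'.le_succ))
            (ZMod (p ^ cyclotomicExponent p)) a)) *
          (ratPlusSymbol g ((a.val : ℚ) / ((p ^ (m' + 1) : ℕ) : ℚ)) : ℂ_[p])) := by
      rw [Finset.mul_sum, Finset.mul_sum]
      refine Finset.sum_congr rfl fun a _ ↦ ?_
      rw [twistPartnerMeasure_succ,
        teichWeight_half_castHom_eq_legendreChar p hp2 (he.trans m'.le_succ) a, legendreChar_inv]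
      simp only [hΦ, map_mul, map_ratCast, Nat.cast_pow]
      ring
    -- the series: `ι([T^k](C(c)·B))·T^k = ι(c)·(ι([T^k]B)·T^k)`
    have hfun : (fun k : ℕ ↦ ι (PowerSeries.coeff k (PowerSeries.C (c : ℚ_[p]) *
          padicLFunctionBranch g α (p / 2))) *
            (κ (cyclotomicGenerator p : ZMod (p ^ (m' + 1))) - 1) ^ k) =
        fun k : ℕ ↦ ι (c : ℚ_[p]) * (ι (PowerSeries.coeff k (padicLFunctionBranch g α (p / 2))) *
          (κ (cyclotomicGenerator p : ZMod (p ^ (m' + 1))) - 1) ^ k) := by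
      funext k
      rw [PowerSeries.coeff_C_mul, map_mul, mul_assoc]
    rw [hfun, ← hval, hv]
    exact h2

/-! ### §3 Uniqueness: EVERY E-normalised tame branch on defect 2 is that series -/

/-- **Every E-normalised tame branch for `(f, χ_p, unitRoot V p)` IS `C(c)·L_p(g, α, ω^{(p−1)/2}, T)`**
(§2 + `IsTameBranchOf.unique`: two bounded interpolants with the same package coincide). In
particular cc-typer-2's existential branch of `exists_isTameBranchOf_legendre_of_goodOrd` (the
Mellin transform of the stabilised twist-partner measure) is this named power series.
[cite: MazurTateTeitelbaum1986Invent, §I.11 and §I.14 (14.3)] -/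
theorem IsTameBranchOf.eq_C_mul_padicLFunctionBranch (hp2 : p ≠ 2) (hord : IsOrdinaryAt V p)
    (hg : IsNewformOf V g) {c : ℚ} (hrel : LegendreTwistPlusRel p f g c) {B : PowerSeries ℚ_[p]}
    (hB : IsTameBranchOf f p ((legendreChar p).ringHomComp (algebraMap ℚ_[p] ℂ_[p]))
      (unitRoot V p : ℚ_[p]) B) :
    B = PowerSeries.C (c : ℚ_[p]) * padicLFunctionBranch g (unitRoot V p : ℚ_[p]) (p / 2) :=
  hB.unique (isTameBranchOf_legendre_C_mul_padicLFunctionBranch V hp2 hord hg hrel)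

/-- `↔` form: under the Legendre twist relation, being an E-normalised tame branch for
`(f, χ_p, unitRoot V p)` is EQUIVALENT to being `C(c)·L_p(g, α, ω^{(p−1)/2}, T)`. [folklore] -/
theorem isTameBranchOf_legendre_iff_eq_C_mul_padicLFunctionBranch (hp2 : p ≠ 2)
    (hord : IsOrdinaryAt V p) (hg : IsNewformOf V g) {c : ℚ} (hrel : LegendreTwistPlusRel p f g c)
    (B : PowerSeries ℚ_[p]) :
    IsTameBranchOf f p ((legendreChar p).ringHomComp (algebraMap ℚ_[p] ℂ_[p]))
        (unitRoot V p : ℚ_[p]) B ↔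
      B = PowerSeries.C (c : ℚ_[p]) * padicLFunctionBranch g (unitRoot V p : ℚ_[p]) (p / 2) :=
  ⟨fun hB ↦ hB.eq_C_mul_padicLFunctionBranch V hp2 hord hg hrel,
    fun h ↦ h ▸ isTameBranchOf_legendre_C_mul_padicLFunctionBranch V hp2 hord hg hrel⟩

/-- **Curve level, `p ≡ 1 (mod 4)`, UNCONDITIONAL.** For `E = W ≅ V ⊗ χ_p` additive at `p`, `V`
globally minimal GOOD ORDINARY at `p`, `f`, `g` the newforms of `W`, `V`: there is `c ∈ ℚ` such that
the E-normalised tame branches of `(f, χ_p, unitRoot V p)` are EXACTLY the one series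
`C(c)·L_p(g, unitRoot V p, ω^{(p−1)/2}, T)` — the comparison hypothesis discharged by cc-typer-2's
`exists_legendreTwistPlusRel_of_twist`. [cite: MazurTateTeitelbaum1986Invent, §I.13–I.14 (14.3)]
[cite: Shimura1971, Prop. 3.64] -/
theorem exists_forall_isTameBranchOf_iff_of_goodOrd_twist (hp4 : p % 4 = 1)
    (W : WeierstrassCurve ℚ) [W.IsElliptic] [NeZero N]
    (hVW : ∃ C : VariableChange ℚ, C • V.quadraticTwist (p : ℚ) = W) (hadd : Addv W p)
    (hord : GoodOrd V p) (hf : IsNewformOf W f) (hg : IsNewformOf V g) :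
    ∃ c : ℚ, ∀ B : PowerSeries ℚ_[p],
      IsTameBranchOf f p ((legendreChar p).ringHomComp (algebraMap ℚ_[p] ℂ_[p]))
          (unitRoot V p : ℚ_[p]) B ↔
        B = PowerSeries.C (c : ℚ_[p]) * padicLFunctionBranch g (unitRoot V p : ℚ_[p]) (p / 2) := by
  have hp2 : p ≠ 2 := (ne_two_and_legendreSym_neg_one_of_mod_four_eq_one (p := p) hp4).1
  obtain ⟨c, hrel⟩ := exists_legendreTwistPlusRel_of_twist hp4 V W hVW hadd hf hg
  exact ⟨c, fun B ↦ isTameBranchOf_legendre_iff_eq_C_mul_padicLFunctionBranch V hp2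
    ((isOrdinaryAt_iff V p).mpr hord) hg hrel B⟩

/-- **Dichotomy for EVERY tuple of the package** (with gen 21's tuple rigidity
`IsTameBranchOf.eq_zero_or_tuple_eq`): under the Legendre twist relation with
`c·L_p(g, α, ω^{(p−1)/2}, T) ≠ 0`, every tuple `(ε', α', B')` with `IsTameBranchOf f p ε' α' B'` is
either degenerate (`α' = 0 ∧ B' = 0`) or `ε' = ι∘χ_p`, `α' = unitRoot V p` and
`B' = C(c)·L_p(g, α, ω^{(p−1)/2}, T)` — the universal quantification over `(ε, a, B)` in
`TameBranchRatCharEqAt` / `TameBranchRatDvdAt` / A227 ranges, on these rows, over ONE NAMED series.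
[folklore] -/
theorem IsTameBranchOf.eq_zero_or_eq_C_mul_padicLFunctionBranch (hp2 : p ≠ 2)
    (hord : IsOrdinaryAt V p) (hg : IsNewformOf V g) {c : ℚ} (hrel : LegendreTwistPlusRel p f g c)
    (hne : PowerSeries.C (c : ℚ_[p]) * padicLFunctionBranch g (unitRoot V p : ℚ_[p]) (p / 2) ≠ 0)
    {ε' : DirichletCharacter ℂ_[p] p} {α' : ℚ_[p]} {B' : PowerSeries ℚ_[p]}
    (h' : IsTameBranchOf f p ε' α' B') :
    (α' = 0 ∧ B' = 0) ∨
      (ε' = (legendreChar p).ringHomComp (algebraMap ℚ_[p] ℂ_[p]) ∧ α' = (unitRoot V p : ℚ_[p]) ∧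
        B' = PowerSeries.C (c : ℚ_[p]) * padicLFunctionBranch g (unitRoot V p : ℚ_[p]) (p / 2)) :=
  IsTameBranchOf.eq_zero_or_tuple_eq hp2
    (isTameBranchOf_legendre_C_mul_padicLFunctionBranch V hp2 hord hg hrel) h' hne

end Dictionary

end Summit.BirchSwinnertonDyer.Rank1Residual.Additive

end
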